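import Summits.BirchSwinnertonDyer.BirchSwinnertonDyer.Theorems.PrintX10bControlGlueOfClauses
import Literature.NumberTheory.EllipticCurves.IwasawaSelmerReadoutIndexOfLocalProofs
import Literature.NumberTheory.GaloisCohomology.ArchimedeanInvariantMap
import HarnessLib

/-!
# `stub_readoutIndex` (B5) OF THE SHARED μ-CRUX FROM PLACE-WISE CLAUSES: `readoutIndex_of_localClauses`
# (helper for `MuInequalityCoherentPairOfPrintCG`, stmt-BirchSwinnertonDyer-23428; cell `pub/bsd-print-x9`, seat
# `bsd-line-x10b-p1-w2` g11, brick (B5-GLOB); sequel of `PrintX10bControlGlueOfClauses` (DG4, p670216))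

Summits-side helper: three statement ABBREVIATIONS (letters, nothing asserted), one small lemma and ONE theorem; no named
fact, no instance, no `sorry`. ROUTE-INDEPENDENT (no `Theses` import).

Skeleton v8 of the μ-crux derives `stub_controlGlue := controlGlue_of_clauses stub_readoutSelmer stub_readoutIndex` (p670216);
`Stmt.readoutIndex` (B5) is the `m`-UNIFORM bound `#(Sel_∞[ψ_m] ⧸ readout(H¹_{F_𝔮}(K, A_𝔮))) ≤ p^c` (Howard Prop. 2.2.8, second
map, at `𝔮 = T^m + p`). The bookkeeping landed for it — p671042 (`Sel_∞[ψ_m] ⧸ … ≅ 𝒢 ⧸ H¹_F ∩ 𝒢`, `𝒢 = readout⁻¹(Sel_∞)`),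
p672668 (level-wise: `𝒢 ⧸ … = ⋃_j` of the level quotients), p672270 (place-wise: a level quotient embeds in the product
of LOCAL quotients at finitely many places), p673136 (the E-side wrapper with (B1)/(B2) discharged) — reduces (B5) to
PLACE-WISE statements about the classes `c ∈ H¹(K, T_j)` (one tower level `j` at a time) whose readout is Selmer over
`K_∞`. This file writes those statements as LETTERS in the quantifier discipline of `Stmt.readoutIndex` (constants
BEFORE `m`; the datum `S … hek` after `m`, `S` confined above `pN` by `_hSN`/`_hSσ`) and assembles them:

* `Stmt.readoutLocalOff` — **(B5-OFF)** at the finite places OUTSIDE `S` (good reduction, `v ∤ p`) such a class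
  satisfies Howard's propagated condition `condA F j v` («no cokernel contribution at the good places»: the Selmer
  condition at `w ∤ p` over `K_∞` is VANISHING, `E(K_{∞,w}) ⊗ ℚ_p/ℤ_p = 0`, and a class dying over the unramified
  `K_{∞,w}/K_v` is unramified);
* `Stmt.readoutLocalIndexP` — **(B5-P)** at `v ∈ S` with `v ∣ p`: a relaxed local condition `F'_v ∋ loc_v c` of index
  `≤ p^c` over `condA F j v ∩ F'_v`, `c` INDEPENDENT of `m`, `j` and the datum (Coates–Greenberg / Greenberg LNM 1716
  Prop. 2.4 at `w ∣ p` + the `m`-uniform count of `H¹(K_v, gr) → H¹(K_{∞,w}, gr)`-kernels, cf. p672759);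
* `Stmt.readoutLocalIndexBad` — **(B5-BAD)** the same at `v ∈ S` with `v ∤ p` (so `v ∣ N` by `_hSN`: bad reduction;
  classes dying over `K_{∞,w}`, counted by `H¹(Γ_v, E(K_{∞,w})[p^∞] ⊗ S_m(ψ⁻¹))`, uniform in `m`);
* `galoisCohomology_one_toLocal_inl_eq_zero_of_isComplex` — at a COMPLEX place `H¹(K_w, ·) = 0` (so the infinite
  places impose nothing; `K` is imaginary quadratic);
* **`readoutIndex_of_localClauses : Stmt.readoutLocalOff → Stmt.readoutLocalIndexP → Stmt.readoutLocalIndexBad →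
  Stmt.readoutIndex`** — with `c := (c_P + c_Bad) · #{v : v ∣ pN}` and `m₁ := m₁^off + m₁^P + m₁^Bad`, through p673136
  `finite_and_natCard_kerPsi_quotient_eisensteinTowerReadout_le_of_local` (`hγ := hyp.topGenerator`,
  `hE := hyp.noPTorsion`), the relaxed conditions being CHOSEN from the letters (`⊤` elsewhere).

So a skeleton may register `stub_readoutLocalOff / stub_readoutLocalIndexP / stub_readoutLocalIndexBad` and DERIVE
`stub_readoutIndex := readoutIndex_of_localClauses stub_readoutLocalOff stub_readoutLocalIndexP stub_readoutLocalIndexBad`.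
HONEST FRAMING: the three clauses are the arithmetic content of (B5) and are NOT proved here; «beyond-print theorem»: no.
BSD is not proved by any of this; no summit statement is proved by this seat.

References: [Howard2004HeegnerKolyvagin] Prop. 2.2.8 (second map) and proof of Thm. 2.2.10 (𝔮 = T^m + p);
[GreenbergLNM1716] Prop. 2.4, §3 Lemma 3.3, §4 pp. 98, 104; [MastellaZerman2026] Thm. 2.40.
-/

set_option linter.dupNamespace false
set_option autoImplicit false

noncomputable section

open scoped Classical Pointwise ContRepresentation TensorProduct NumberField

open Function NumberField IsDedekindDomain Field
open Literature Literature.NumberTheory.EllipticCurves WeierstrassCurve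
open Literature.NumberTheory.GaloisCohomology Literature.NumberTheory.GaloisCohomology.Howard2004
open Literature.NumberTheory.GaloisRepresentations Literature.NumberTheory.GaloisRepresentations.DiscreteGaloisModule
open Summit.BirchSwinnertonDyer.BirchSwinnertonDyer.Theorems

namespace Summit.BirchSwinnertonDyer.BirchSwinnertonDyer.Theorems.HeegnerMuPartControlGlue

/-! ## §0 At a complex place `H¹(K_w, ·) = 0` -/

/-- **At a COMPLEX place `w`, `H¹(K_w, M) = 0`** for every discrete `Γ_K`-module `M` (`Γ_{K_w} = 1`, tree
`eq_one_absoluteGaloisGroup_of_isComplex`; a `1`-cocycle on the trivial group is the zero coboundary).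
[cite: GreenbergLNM1716, §3 p. 87 (archimedean primes split completely)] [cite: SerreGaloisCohomology1997, I §2.2] -/
theorem galoisCohomology_one_toLocal_inl_eq_zero_of_isComplex {K : Type} [Field K] [NumberField K] {M : Type}
    [AddCommGroup M] [TopologicalSpace M] [DiscreteTopology M] (ρ : DiscreteGaloisModule K M)
    {w : InfinitePlace K} (hw : w.IsComplex) (c : galoisCohomology (ρ.toLocal (Sum.inl w)) 1) : c = 0 := by
  obtain ⟨φ, rfl⟩ := oneCocycleClass_surjective (ρ.toLocal (Sum.inl w)).toTopRep c
  refine (oneCocycleClass_eq_zero_iff (ρ.toLocal (Sum.inl w)).toTopRep φ).mpr ⟨0, fun g ↦ ?_⟩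
  rw [Literature.NumberTheory.GaloisCohomology.eq_one_absoluteGaloisGroup_of_isComplex hw g,
    contOneCocycles.apply_one, map_one, map_zero, sub_zero]

/-! ## §1 The letters -/

set_option synthInstance.maxHeartbeats 80000 in
/-- **Letter (B5-OFF) `readoutLocalOff`** — at the finite places OUTSIDE `S`, for `m ≫ 0`, every admissible Eisenstein
datum and every tower level `j ≥ j₀`: a class `c ∈ H¹(K, T_j)` whose readout lies in `Sel_{p^∞}(E/K_∞)` has
`loc_v c ∈ condA F j v` (Howard's propagated condition; «no cokernel contribution at the good places»; Howard 2004
Prop. 2.2.8 and proof of Thm. 2.2.10, Greenberg LNM 1716 §3 Lemma 3.3 and §4 p. 104). A LETTER (nothing asserted). -/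
abbrev Stmt.readoutLocalOff : Prop :=
  Literature.NumberTheory.EllipticCurves.Greenberg1999.imKummer_eq_strictCondition_goodOrdinary_numberField →
  ∀ (N : ℕ) [NeZero N] (W : WeierstrassCurve ℚ) [W.IsGloballyMinimal] (K : Type) [Field K] [NumberField K]
    (p : ℕ) [Fact p.Prime] (κ : ZpExtension K p) (γ : Field.absoluteGaloisGroup K)
    (jbar : AlgebraicClosure K →+* ℂ) (hyp : CastellaGrossiLeeSkinner2022.Thm413Hypotheses N W K p κ γ),
    ¬ W.HasCM → W.HasIrreducibleModPGaloisRep p → (W.baseChange K).HasIrreducibleModPGaloisRep p →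
    MastellaZerman2026.HasPadicScalarImage W p → SatisfiesHeegnerHypothesis p K →
    p ∣ NumberField.classNumber K →
    ∃ m₁ : ℕ, ∀ (m : ℕ) (hm : 1 ≤ m), m₁ ≤ m →
      haveI := hyp.isElliptic
      letI := IwasawaAlgebra.isDomain_quotient_X_pow_add_C p hm
      letI := IwasawaAlgebra.isDiscreteValuationRing_quotient_X_pow_add_C p hm
      haveI := IwasawaAlgebra.EisensteinCoeff.isLocalRing_succ p hm
      letI := IwasawaAlgebra.EisensteinCoeff.algebraOfSpecSucc p m
      haveI := W.isScalarTower_algebraOfSpecSucc (K := K) (p := p) (m := m)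
      letI := W.residueModuleSucc (K := K) (p := p) hm
      ∀ (S : Finset (IsDedekindDomain.HeightOneSpectrum (NumberField.RingOfIntegers K)))
        (hpS : ∀ v, ((p : ℕ) : NumberField.RingOfIntegers K) ∈ v.asIdeal → v ∈ S)
        (hbad : ∀ v, v ∉ S → ((p : ℕ) : NumberField.RingOfIntegers K) ∉ v.asIdeal →
          (W.baseChange K).HasGoodReductionAt v)
        (_hSN : ∀ v ∈ S, ((p : ℕ) : NumberField.RingOfIntegers K) ∈ v.asIdeal ∨
          ((N : ℕ) : NumberField.RingOfIntegers K) ∈ v.asIdeal)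
        (_hSσ : ∀ (σ : K ≃ₐ[ℚ] K) (v : IsDedekindDomain.HeightOneSpectrum (NumberField.RingOfIntegers K)),
          σ • v ∈ S → v ∈ S)
        (L : Set (IsDedekindDomain.HeightOneSpectrum (NumberField.RingOfIntegers K)))
        (hL : L ⊆ (W.eisensteinTower (κ.unitTwist (-1)) hm).degreeTwoPrimes p)
        (hLS : ∀ v ∈ L, v ∉ S) (jbar' : AlgebraicClosure K →+* ℂ) (cd : ConjugationDatum K)
        (Dd : ∀ k, DualityDatum p cd ((W.eisensteinTower (κ.unitTwist (-1)) hm).ρ k)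
          (IwasawaAlgebra.EisensteinCoeff p m (k + 1)))
        (fs : ∀ (k : ℕ) (n : Finset (IsDedekindDomain.HeightOneSpectrum (NumberField.RingOfIntegers K)))
          (v : IsDedekindDomain.HeightOneSpectrum (NumberField.RingOfIntegers K)),
          galoisCohomology ((W.eisensteinLevelQuot (κ.unitTwist (-1)) hm k n).toLocal (Sum.inr v)) 1 →+
            SingularQuotient (GaloisRep.toLocal v (W.eisensteinLevelQuot (κ.unitTwist (-1)) hm k n)) ⊗[ℤ]
              Gell v)
        (hy : (W.eisensteinDVRSetting (κ.unitTwist (-1)) hm S hpS hbad L hL hLS jbar' cd Dd fs).SatisfiesH)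
        (hπ : (W.eisensteinDVRSetting (κ.unitTwist (-1)) hm S hpS hbad L hL hLS jbar' cd Dd fs).π ∈ IsLocalRing.maximalIdeal (IwasawaAlgebra p ⧸ Ideal.span {(PowerSeries.X ^ m + PowerSeries.C (p : ℤ_[p]) : IwasawaAlgebra p)}))
        (he : ∀ k, (W.eisensteinDVRSetting (κ.unitTwist (-1)) hm S hpS hbad L hL hLS jbar' cd Dd fs).e k ≤ (W.eisensteinDVRSetting (κ.unitTwist (-1)) hm S hpS hbad L hL hLS jbar' cd Dd fs).e (k + 1))
        (hπX : (W.eisensteinDVRSetting (κ.unitTwist (-1)) hm S hpS hbad L hL hLS jbar' cd Dd fs).π =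
          Ideal.Quotient.mk (Ideal.span {(PowerSeries.X ^ m + PowerSeries.C (p : ℤ_[p]) : IwasawaAlgebra p)}) PowerSeries.X)
        (hek : ∀ k, (W.eisensteinDVRSetting (κ.unitTwist (-1)) hm S hpS hbad L hL hLS jbar' cd Dd fs).e (k + 1) - (W.eisensteinDVRSetting (κ.unitTwist (-1)) hm S hpS hbad L hL hLS jbar' cd Dd fs).e k = m),
        ∃ j₀ : ℕ, ∀ (j : ℕ), j₀ ≤ j → ∀ c : galoisCohomology ((W.eisensteinDVRSetting (κ.unitTwist (-1)) hm S hpS hbad L hL hLS jbar' cd Dd fs).T.ρ j) 1,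
          W.eisensteinTowerReadout κ hm (W.eisensteinDVRSetting (κ.unitTwist (-1)) hm S hpS hbad L hL hLS jbar' cd Dd fs).π (W.eisensteinDVRSetting (κ.unitTwist (-1)) hm S hpS hbad L hL hLS jbar' cd Dd fs).e hy.killed hy.ker_red hπ he hπX hek
              (AddCommGroup.DirectLimit.of (fun k => galoisCohomology ((W.eisensteinDVRSetting (κ.unitTwist (-1)) hm S hpS hbad L hL hLS jbar' cd Dd fs).T.ρ k) 1)
                (AdicTower.incH1LE (W.eisensteinDVRSetting (κ.unitTwist (-1)) hm S hpS hbad L hL hLS jbar' cd Dd fs).T (W.eisensteinDVRSetting (κ.unitTwist (-1)) hm S hpS hbad L hL hLS jbar' cd Dd fs).π (W.eisensteinDVRSetting (κ.unitTwist (-1)) hm S hpS hbad L hL hLS jbar' cd Dd fs).e hy.killed hy.ker_red hπ he) j c) ∈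
            (W.baseChange K).selmerInfty κ →
          ∀ v : IsDedekindDomain.HeightOneSpectrum (NumberField.RingOfIntegers K), v ∉ S →
            galoisCohomology.localization ((W.eisensteinDVRSetting (κ.unitTwist (-1)) hm S hpS hbad L hL hLS jbar' cd Dd fs).T.ρ j) (Sum.inr v) 1 c ∈
              AdicTower.condA (W.eisensteinDVRSetting (κ.unitTwist (-1)) hm S hpS hbad L hL hLS jbar' cd Dd fs).T (W.eisensteinDVRSetting (κ.unitTwist (-1)) hm S hpS hbad L hL hLS jbar' cd Dd fs).π (W.eisensteinDVRSetting (κ.unitTwist (-1)) hm S hpS hbad L hL hLS jbar' cd Dd fs).e hy.killed hy.ker_red hπ he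
                (fun k => ((W.eisensteinDVRSetting (κ.unitTwist (-1)) hm S hpS hbad L hL hLS jbar' cd Dd fs).t k).cond) j (Sum.inr v)

set_option synthInstance.maxHeartbeats 80000 in
/-- **Letter (B5-P) `readoutLocalIndexP`** — at the places `v ∈ S` ABOVE `p`, for `m ≫ 0`, every admissible Eisenstein
datum and every tower level `j ≥ j₀`: a relaxed local condition `F'_v ≤ H¹(K_v, T_j)` containing `loc_v c` for every class
`c ∈ H¹(K, T_j)` whose readout lies in `Sel_{p^∞}(E/K_∞)`, with `F'_v ⧸ (condA F j v ∩ F'_v)` finite of order `≤ p^c`, the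
constant `c` INDEPENDENT of `m`, `j` and the datum (Coates–Greenberg at `w ∣ p`: Greenberg LNM 1716 Prop. 2.4 is the
leading binder; the `m`-uniform kernel count of `H¹(K_v, gr) → H¹(K_{∞,w}, gr)`; Howard 2004 Prop. 2.2.8 and proof of
Thm. 2.2.10, Greenberg LNM 1716 Prop. 2.4 and §4 pp. 98, 104). A LETTER (nothing asserted). -/
abbrev Stmt.readoutLocalIndexP : Prop :=
  Literature.NumberTheory.EllipticCurves.Greenberg1999.imKummer_eq_strictCondition_goodOrdinary_numberField →
  ∀ (N : ℕ) [NeZero N] (W : WeierstrassCurve ℚ) [W.IsGloballyMinimal] (K : Type) [Field K] [NumberField K]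
    (p : ℕ) [Fact p.Prime] (κ : ZpExtension K p) (γ : Field.absoluteGaloisGroup K)
    (jbar : AlgebraicClosure K →+* ℂ) (hyp : CastellaGrossiLeeSkinner2022.Thm413Hypotheses N W K p κ γ),
    ¬ W.HasCM → W.HasIrreducibleModPGaloisRep p → (W.baseChange K).HasIrreducibleModPGaloisRep p →
    MastellaZerman2026.HasPadicScalarImage W p → SatisfiesHeegnerHypothesis p K →
    p ∣ NumberField.classNumber K →
    ∃ c m₁ : ℕ, ∀ (m : ℕ) (hm : 1 ≤ m), m₁ ≤ m →
      haveI := hyp.isElliptic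
      letI := IwasawaAlgebra.isDomain_quotient_X_pow_add_C p hm
      letI := IwasawaAlgebra.isDiscreteValuationRing_quotient_X_pow_add_C p hm
      haveI := IwasawaAlgebra.EisensteinCoeff.isLocalRing_succ p hm
      letI := IwasawaAlgebra.EisensteinCoeff.algebraOfSpecSucc p m
      haveI := W.isScalarTower_algebraOfSpecSucc (K := K) (p := p) (m := m)
      letI := W.residueModuleSucc (K := K) (p := p) hm
      ∀ (S : Finset (IsDedekindDomain.HeightOneSpectrum (NumberField.RingOfIntegers K)))
        (hpS : ∀ v, ((p : ℕ) : NumberField.RingOfIntegers K) ∈ v.asIdeal → v ∈ S)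
        (hbad : ∀ v, v ∉ S → ((p : ℕ) : NumberField.RingOfIntegers K) ∉ v.asIdeal →
          (W.baseChange K).HasGoodReductionAt v)
        (_hSN : ∀ v ∈ S, ((p : ℕ) : NumberField.RingOfIntegers K) ∈ v.asIdeal ∨
          ((N : ℕ) : NumberField.RingOfIntegers K) ∈ v.asIdeal)
        (_hSσ : ∀ (σ : K ≃ₐ[ℚ] K) (v : IsDedekindDomain.HeightOneSpectrum (NumberField.RingOfIntegers K)),
          σ • v ∈ S → v ∈ S)
        (L : Set (IsDedekindDomain.HeightOneSpectrum (NumberField.RingOfIntegers K)))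
        (hL : L ⊆ (W.eisensteinTower (κ.unitTwist (-1)) hm).degreeTwoPrimes p)
        (hLS : ∀ v ∈ L, v ∉ S) (jbar' : AlgebraicClosure K →+* ℂ) (cd : ConjugationDatum K)
        (Dd : ∀ k, DualityDatum p cd ((W.eisensteinTower (κ.unitTwist (-1)) hm).ρ k)
          (IwasawaAlgebra.EisensteinCoeff p m (k + 1)))
        (fs : ∀ (k : ℕ) (n : Finset (IsDedekindDomain.HeightOneSpectrum (NumberField.RingOfIntegers K)))
          (v : IsDedekindDomain.HeightOneSpectrum (NumberField.RingOfIntegers K)),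
          galoisCohomology ((W.eisensteinLevelQuot (κ.unitTwist (-1)) hm k n).toLocal (Sum.inr v)) 1 →+
            SingularQuotient (GaloisRep.toLocal v (W.eisensteinLevelQuot (κ.unitTwist (-1)) hm k n)) ⊗[ℤ]
              Gell v)
        (hy : (W.eisensteinDVRSetting (κ.unitTwist (-1)) hm S hpS hbad L hL hLS jbar' cd Dd fs).SatisfiesH)
        (hπ : (W.eisensteinDVRSetting (κ.unitTwist (-1)) hm S hpS hbad L hL hLS jbar' cd Dd fs).π ∈ IsLocalRing.maximalIdeal (IwasawaAlgebra p ⧸ Ideal.span {(PowerSeries.X ^ m + PowerSeries.C (p : ℤ_[p]) : IwasawaAlgebra p)}))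
        (he : ∀ k, (W.eisensteinDVRSetting (κ.unitTwist (-1)) hm S hpS hbad L hL hLS jbar' cd Dd fs).e k ≤ (W.eisensteinDVRSetting (κ.unitTwist (-1)) hm S hpS hbad L hL hLS jbar' cd Dd fs).e (k + 1))
        (hπX : (W.eisensteinDVRSetting (κ.unitTwist (-1)) hm S hpS hbad L hL hLS jbar' cd Dd fs).π =
          Ideal.Quotient.mk (Ideal.span {(PowerSeries.X ^ m + PowerSeries.C (p : ℤ_[p]) : IwasawaAlgebra p)}) PowerSeries.X)
        (hek : ∀ k, (W.eisensteinDVRSetting (κ.unitTwist (-1)) hm S hpS hbad L hL hLS jbar' cd Dd fs).e (k + 1) - (W.eisensteinDVRSetting (κ.unitTwist (-1)) hm S hpS hbad L hL hLS jbar' cd Dd fs).e k = m),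
        ∃ j₀ : ℕ, ∀ (j : ℕ), j₀ ≤ j →
          ∀ v ∈ S, ((p : ℕ) : NumberField.RingOfIntegers K) ∈ v.asIdeal →
            ∃ Fv : AddSubgroup (galoisCohomology (((W.eisensteinDVRSetting (κ.unitTwist (-1)) hm S hpS hbad L hL hLS jbar' cd Dd fs).T.ρ j).toLocal (Sum.inr v)) 1),
              (∀ c : galoisCohomology ((W.eisensteinDVRSetting (κ.unitTwist (-1)) hm S hpS hbad L hL hLS jbar' cd Dd fs).T.ρ j) 1,
                W.eisensteinTowerReadout κ hm (W.eisensteinDVRSetting (κ.unitTwist (-1)) hm S hpS hbad L hL hLS jbar' cd Dd fs).π (W.eisensteinDVRSetting (κ.unitTwist (-1)) hm S hpS hbad L hL hLS jbar' cd Dd fs).e hy.killed hy.ker_red hπ he hπX hek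
              (AddCommGroup.DirectLimit.of (fun k => galoisCohomology ((W.eisensteinDVRSetting (κ.unitTwist (-1)) hm S hpS hbad L hL hLS jbar' cd Dd fs).T.ρ k) 1)
                (AdicTower.incH1LE (W.eisensteinDVRSetting (κ.unitTwist (-1)) hm S hpS hbad L hL hLS jbar' cd Dd fs).T (W.eisensteinDVRSetting (κ.unitTwist (-1)) hm S hpS hbad L hL hLS jbar' cd Dd fs).π (W.eisensteinDVRSetting (κ.unitTwist (-1)) hm S hpS hbad L hL hLS jbar' cd Dd fs).e hy.killed hy.ker_red hπ he) j c) ∈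
            (W.baseChange K).selmerInfty κ →
                galoisCohomology.localization ((W.eisensteinDVRSetting (κ.unitTwist (-1)) hm S hpS hbad L hL hLS jbar' cd Dd fs).T.ρ j) (Sum.inr v) 1 c ∈ Fv) ∧
              Finite (↥Fv ⧸ (AdicTower.condA (W.eisensteinDVRSetting (κ.unitTwist (-1)) hm S hpS hbad L hL hLS jbar' cd Dd fs).T (W.eisensteinDVRSetting (κ.unitTwist (-1)) hm S hpS hbad L hL hLS jbar' cd Dd fs).π (W.eisensteinDVRSetting (κ.unitTwist (-1)) hm S hpS hbad L hL hLS jbar' cd Dd fs).e hy.killed hy.ker_red hπ he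
                (fun k => ((W.eisensteinDVRSetting (κ.unitTwist (-1)) hm S hpS hbad L hL hLS jbar' cd Dd fs).t k).cond) j (Sum.inr v)).addSubgroupOf Fv) ∧
              Nat.card (↥Fv ⧸ (AdicTower.condA (W.eisensteinDVRSetting (κ.unitTwist (-1)) hm S hpS hbad L hL hLS jbar' cd Dd fs).T (W.eisensteinDVRSetting (κ.unitTwist (-1)) hm S hpS hbad L hL hLS jbar' cd Dd fs).π (W.eisensteinDVRSetting (κ.unitTwist (-1)) hm S hpS hbad L hL hLS jbar' cd Dd fs).e hy.killed hy.ker_red hπ he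
                (fun k => ((W.eisensteinDVRSetting (κ.unitTwist (-1)) hm S hpS hbad L hL hLS jbar' cd Dd fs).t k).cond) j (Sum.inr v)).addSubgroupOf Fv) ≤ p ^ c

set_option synthInstance.maxHeartbeats 80000 in
/-- **Letter (B5-BAD) `readoutLocalIndexBad`** — at the places `v ∈ S` NOT above `p` (so above `N`, by `_hSN`: bad
reduction), for `m ≫ 0`, every admissible Eisenstein datum and every tower level `j ≥ j₀`: a relaxed local condition
`F'_v ≤ H¹(K_v, T_j)` containing `loc_v c` for every class `c ∈ H¹(K, T_j)` whose readout lies in `Sel_{p^∞}(E/K_∞)`, with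
`F'_v ⧸ (condA F j v ∩ F'_v)` finite of order `≤ p^c`, `c` INDEPENDENT of `m`, `j` and the datum (the classes dying over
`K_{∞,w}`, counted by `H¹(Γ_v, E(K_{∞,w})[p^∞] ⊗ S_m(ψ⁻¹))`; Howard 2004 Prop. 2.2.8 and proof of Thm. 2.2.10,
Greenberg LNM 1716 §3 Lemma 3.3 and §4 pp. 98, 104). A LETTER (nothing asserted). -/
abbrev Stmt.readoutLocalIndexBad : Prop :=
  Literature.NumberTheory.EllipticCurves.Greenberg1999.imKummer_eq_strictCondition_goodOrdinary_numberField →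
  ∀ (N : ℕ) [NeZero N] (W : WeierstrassCurve ℚ) [W.IsGloballyMinimal] (K : Type) [Field K] [NumberField K]
    (p : ℕ) [Fact p.Prime] (κ : ZpExtension K p) (γ : Field.absoluteGaloisGroup K)
    (jbar : AlgebraicClosure K →+* ℂ) (hyp : CastellaGrossiLeeSkinner2022.Thm413Hypotheses N W K p κ γ),
    ¬ W.HasCM → W.HasIrreducibleModPGaloisRep p → (W.baseChange K).HasIrreducibleModPGaloisRep p →
    MastellaZerman2026.HasPadicScalarImage W p → SatisfiesHeegnerHypothesis p K →
    p ∣ NumberField.classNumber K →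
    ∃ c m₁ : ℕ, ∀ (m : ℕ) (hm : 1 ≤ m), m₁ ≤ m →
      haveI := hyp.isElliptic
      letI := IwasawaAlgebra.isDomain_quotient_X_pow_add_C p hm
      letI := IwasawaAlgebra.isDiscreteValuationRing_quotient_X_pow_add_C p hm
      haveI := IwasawaAlgebra.EisensteinCoeff.isLocalRing_succ p hm
      letI := IwasawaAlgebra.EisensteinCoeff.algebraOfSpecSucc p m
      haveI := W.isScalarTower_algebraOfSpecSucc (K := K) (p := p) (m := m)
      letI := W.residueModuleSucc (K := K) (p := p) hm
      ∀ (S : Finset (IsDedekindDomain.HeightOneSpectrum (NumberField.RingOfIntegers K)))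
        (hpS : ∀ v, ((p : ℕ) : NumberField.RingOfIntegers K) ∈ v.asIdeal → v ∈ S)
        (hbad : ∀ v, v ∉ S → ((p : ℕ) : NumberField.RingOfIntegers K) ∉ v.asIdeal →
          (W.baseChange K).HasGoodReductionAt v)
        (_hSN : ∀ v ∈ S, ((p : ℕ) : NumberField.RingOfIntegers K) ∈ v.asIdeal ∨
          ((N : ℕ) : NumberField.RingOfIntegers K) ∈ v.asIdeal)
        (_hSσ : ∀ (σ : K ≃ₐ[ℚ] K) (v : IsDedekindDomain.HeightOneSpectrum (NumberField.RingOfIntegers K)),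
          σ • v ∈ S → v ∈ S)
        (L : Set (IsDedekindDomain.HeightOneSpectrum (NumberField.RingOfIntegers K)))
        (hL : L ⊆ (W.eisensteinTower (κ.unitTwist (-1)) hm).degreeTwoPrimes p)
        (hLS : ∀ v ∈ L, v ∉ S) (jbar' : AlgebraicClosure K →+* ℂ) (cd : ConjugationDatum K)
        (Dd : ∀ k, DualityDatum p cd ((W.eisensteinTower (κ.unitTwist (-1)) hm).ρ k)
          (IwasawaAlgebra.EisensteinCoeff p m (k + 1)))
        (fs : ∀ (k : ℕ) (n : Finset (IsDedekindDomain.HeightOneSpectrum (NumberField.RingOfIntegers K)))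
          (v : IsDedekindDomain.HeightOneSpectrum (NumberField.RingOfIntegers K)),
          galoisCohomology ((W.eisensteinLevelQuot (κ.unitTwist (-1)) hm k n).toLocal (Sum.inr v)) 1 →+
            SingularQuotient (GaloisRep.toLocal v (W.eisensteinLevelQuot (κ.unitTwist (-1)) hm k n)) ⊗[ℤ]
              Gell v)
        (hy : (W.eisensteinDVRSetting (κ.unitTwist (-1)) hm S hpS hbad L hL hLS jbar' cd Dd fs).SatisfiesH)
        (hπ : (W.eisensteinDVRSetting (κ.unitTwist (-1)) hm S hpS hbad L hL hLS jbar' cd Dd fs).π ∈ IsLocalRing.maximalIdeal (IwasawaAlgebra p ⧸ Ideal.span {(PowerSeries.X ^ m + PowerSeries.C (p : ℤ_[p]) : IwasawaAlgebra p)}))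
        (he : ∀ k, (W.eisensteinDVRSetting (κ.unitTwist (-1)) hm S hpS hbad L hL hLS jbar' cd Dd fs).e k ≤ (W.eisensteinDVRSetting (κ.unitTwist (-1)) hm S hpS hbad L hL hLS jbar' cd Dd fs).e (k + 1))
        (hπX : (W.eisensteinDVRSetting (κ.unitTwist (-1)) hm S hpS hbad L hL hLS jbar' cd Dd fs).π =
          Ideal.Quotient.mk (Ideal.span {(PowerSeries.X ^ m + PowerSeries.C (p : ℤ_[p]) : IwasawaAlgebra p)}) PowerSeries.X)
        (hek : ∀ k, (W.eisensteinDVRSetting (κ.unitTwist (-1)) hm S hpS hbad L hL hLS jbar' cd Dd fs).e (k + 1) - (W.eisensteinDVRSetting (κ.unitTwist (-1)) hm S hpS hbad L hL hLS jbar' cd Dd fs).e k = m),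
        ∃ j₀ : ℕ, ∀ (j : ℕ), j₀ ≤ j →
          ∀ v ∈ S, ((p : ℕ) : NumberField.RingOfIntegers K) ∉ v.asIdeal →
            ∃ Fv : AddSubgroup (galoisCohomology (((W.eisensteinDVRSetting (κ.unitTwist (-1)) hm S hpS hbad L hL hLS jbar' cd Dd fs).T.ρ j).toLocal (Sum.inr v)) 1),
              (∀ c : galoisCohomology ((W.eisensteinDVRSetting (κ.unitTwist (-1)) hm S hpS hbad L hL hLS jbar' cd Dd fs).T.ρ j) 1,
                W.eisensteinTowerReadout κ hm (W.eisensteinDVRSetting (κ.unitTwist (-1)) hm S hpS hbad L hL hLS jbar' cd Dd fs).π (W.eisensteinDVRSetting (κ.unitTwist (-1)) hm S hpS hbad L hL hLS jbar' cd Dd fs).e hy.killed hy.ker_red hπ he hπX hek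
              (AddCommGroup.DirectLimit.of (fun k => galoisCohomology ((W.eisensteinDVRSetting (κ.unitTwist (-1)) hm S hpS hbad L hL hLS jbar' cd Dd fs).T.ρ k) 1)
                (AdicTower.incH1LE (W.eisensteinDVRSetting (κ.unitTwist (-1)) hm S hpS hbad L hL hLS jbar' cd Dd fs).T (W.eisensteinDVRSetting (κ.unitTwist (-1)) hm S hpS hbad L hL hLS jbar' cd Dd fs).π (W.eisensteinDVRSetting (κ.unitTwist (-1)) hm S hpS hbad L hL hLS jbar' cd Dd fs).e hy.killed hy.ker_red hπ he) j c) ∈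
            (W.baseChange K).selmerInfty κ →
                galoisCohomology.localization ((W.eisensteinDVRSetting (κ.unitTwist (-1)) hm S hpS hbad L hL hLS jbar' cd Dd fs).T.ρ j) (Sum.inr v) 1 c ∈ Fv) ∧
              Finite (↥Fv ⧸ (AdicTower.condA (W.eisensteinDVRSetting (κ.unitTwist (-1)) hm S hpS hbad L hL hLS jbar' cd Dd fs).T (W.eisensteinDVRSetting (κ.unitTwist (-1)) hm S hpS hbad L hL hLS jbar' cd Dd fs).π (W.eisensteinDVRSetting (κ.unitTwist (-1)) hm S hpS hbad L hL hLS jbar' cd Dd fs).e hy.killed hy.ker_red hπ he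
                (fun k => ((W.eisensteinDVRSetting (κ.unitTwist (-1)) hm S hpS hbad L hL hLS jbar' cd Dd fs).t k).cond) j (Sum.inr v)).addSubgroupOf Fv) ∧
              Nat.card (↥Fv ⧸ (AdicTower.condA (W.eisensteinDVRSetting (κ.unitTwist (-1)) hm S hpS hbad L hL hLS jbar' cd Dd fs).T (W.eisensteinDVRSetting (κ.unitTwist (-1)) hm S hpS hbad L hL hLS jbar' cd Dd fs).π (W.eisensteinDVRSetting (κ.unitTwist (-1)) hm S hpS hbad L hL hLS jbar' cd Dd fs).e hy.killed hy.ker_red hπ he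
                (fun k => ((W.eisensteinDVRSetting (κ.unitTwist (-1)) hm S hpS hbad L hL hLS jbar' cd Dd fs).t k).cond) j (Sum.inr v)).addSubgroupOf Fv) ≤ p ^ c

/-! ## §2 The assembly -/

/-- The finite places of `K` above `pN` form a finite set (the possible members of an admissible `S`).
[cite: Howard2004HeegnerKolyvagin, §1.2 (Σ finite)] -/
theorem finite_setOf_mem_or_mem {K : Type} [Field K] [NumberField K] (p N : ℕ) [Fact p.Prime] [NeZero N] :
    Set.Finite {v : IsDedekindDomain.HeightOneSpectrum (NumberField.RingOfIntegers K) |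
      ((p : ℕ) : NumberField.RingOfIntegers K) ∈ v.asIdeal ∨ ((N : ℕ) : NumberField.RingOfIntegers K) ∈ v.asIdeal} := by
  have hp0 : ((p : ℕ) : NumberField.RingOfIntegers K) ≠ 0 := by
    exact_mod_cast (Fact.out : p.Prime).ne_zero
  have hN0 : ((N : ℕ) : NumberField.RingOfIntegers K) ≠ 0 := by
    exact_mod_cast NeZero.ne N
  have hfin : Set.Finite {v : IsDedekindDomain.HeightOneSpectrum (NumberField.RingOfIntegers K) |
      v.asIdeal ∣ Ideal.span {((p : ℕ) : NumberField.RingOfIntegers K) * ((N : ℕ) : NumberField.RingOfIntegers K)}} :=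
    Ideal.finite_factors (show Ideal.span _ ≠ ⊥ by
      rw [Ne, Ideal.span_singleton_eq_bot]
      exact mul_ne_zero hp0 hN0)
  refine hfin.subset fun v hv ↦ ?_
  rw [Set.mem_setOf_eq, Ideal.dvd_span_singleton]
  rcases hv with hv | hv
  · exact Ideal.mul_mem_right _ _ hv
  · exact Ideal.mul_mem_left _ _ hv

set_option maxHeartbeats 4000000 in
set_option synthInstance.maxHeartbeats 80000 in
/-- **`stub_readoutIndex` (B5) from the three place-wise clauses** (see the module docstring for the chain).
[cite: Howard2004HeegnerKolyvagin, Prop. 2.2.8 (second map) and proof of Thm. 2.2.10 (𝔮 = T^m + p)]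
[cite: GreenbergLNM1716, Prop. 2.4, §3 Lemma 3.3 and §4 pp. 98, 104] [cite: MastellaZerman2026, Thm. 2.40] -/
theorem readoutIndex_of_localClauses (hOff : Stmt.readoutLocalOff) (hP : Stmt.readoutLocalIndexP)
    (hBad : Stmt.readoutLocalIndexBad) : Stmt.readoutIndex := by
  intro hCG N _ W _ K _ _ p _ κ γ jbar hyp hCM hirr hirrK hsc hHp hhK
  haveI := hyp.isElliptic
  haveI : IsTotallyComplex K := hyp.isImaginaryQuadratic.isTotallyComplex
  obtain ⟨m₁, hOff₁⟩ := hOff hCG N W K p κ γ jbar hyp hCM hirr hirrK hsc hHp hhK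
  obtain ⟨cP, m₂, hP₁⟩ := hP hCG N W K p κ γ jbar hyp hCM hirr hirrK hsc hHp hhK
  obtain ⟨cB, m₃, hB₁⟩ := hBad hCG N W K p κ γ jbar hyp hCM hirr hirrK hsc hHp hhK
  -- the admissible `S` are confined to the finitely many places above `pN`
  have hS₀ := finite_setOf_mem_or_mem (K := K) p N
  refine ⟨(cP + cB) * hS₀.toFinset.card, m₁ + m₂ + m₃, fun m hm hmle ↦ ?_⟩
  letI := IwasawaAlgebra.isDomain_quotient_X_pow_add_C p hm
  letI := IwasawaAlgebra.isDiscreteValuationRing_quotient_X_pow_add_C p hm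
  haveI := IwasawaAlgebra.EisensteinCoeff.isLocalRing_succ p hm
  letI := IwasawaAlgebra.EisensteinCoeff.algebraOfSpecSucc p m
  haveI := W.isScalarTower_algebraOfSpecSucc (K := K) (p := p) (m := m)
  letI := W.residueModuleSucc (K := K) (p := p) hm
  have hm₁ : m₁ ≤ m := by omega
  have hm₂ : m₂ ≤ m := by omega
  have hm₃ : m₃ ≤ m := by omega
  have hppos : 0 < p := (Fact.out : p.Prime).pos
  intro S hpS hbad hSN hSσ L hL hLS jbar' cd Dd fs hy hπ he hπX hek
  have hScard : S.card ≤ hS₀.toFinset.card :=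
    Finset.card_le_card fun v hv ↦ hS₀.mem_toFinset.mpr (hSN v hv)
  -- the three clauses at this `m` and datum
  obtain ⟨j₁, hOff₂⟩ := hOff₁ m hm hm₁ S hpS hbad hSN hSσ L hL hLS jbar' cd Dd fs hy hπ he hπX hek
  obtain ⟨j₂, hP₂⟩ := hP₁ m hm hm₂ S hpS hbad hSN hSσ L hL hLS jbar' cd Dd fs hy hπ he hπX hek
  obtain ⟨j₃, hB₂⟩ := hB₁ m hm hm₃ S hpS hbad hSN hSσ L hL hLS jbar' cd Dd fs hy hπ he hπX hek
  have hj₁ : ∀ j, j₁ + j₂ + j₃ ≤ j → j₁ ≤ j := fun j h ↦ by omega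
  have hj₂ : ∀ j, j₁ + j₂ + j₃ ≤ j → j₂ ≤ j := fun j h ↦ by omega
  have hj₃ : ∀ j, j₁ + j₂ + j₃ ≤ j → j₃ ≤ j := fun j h ↦ by omega
  -- the relaxed local conditions, CHOSEN from the two index clauses at `v ∈ S` (`⊤` where nothing is asked)
  have hex : ∀ (j : ℕ) (v : IsDedekindDomain.HeightOneSpectrum (NumberField.RingOfIntegers K)),
      ∃ Fv : AddSubgroup (galoisCohomology (((W.eisensteinDVRSetting (κ.unitTwist (-1)) hm S hpS hbad L hL hLS jbar' cd Dd fs).T.ρ j).toLocal (Sum.inr v)) 1),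
        j₁ + j₂ + j₃ ≤ j → v ∈ S →
          (∀ c : galoisCohomology ((W.eisensteinDVRSetting (κ.unitTwist (-1)) hm S hpS hbad L hL hLS jbar' cd Dd fs).T.ρ j) 1,
            W.eisensteinTowerReadout κ hm (W.eisensteinDVRSetting (κ.unitTwist (-1)) hm S hpS hbad L hL hLS jbar' cd Dd fs).π (W.eisensteinDVRSetting (κ.unitTwist (-1)) hm S hpS hbad L hL hLS jbar' cd Dd fs).e hy.killed hy.ker_red hπ he hπX hek
              (AddCommGroup.DirectLimit.of (fun k => galoisCohomology ((W.eisensteinDVRSetting (κ.unitTwist (-1)) hm S hpS hbad L hL hLS jbar' cd Dd fs).T.ρ k) 1)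
                (AdicTower.incH1LE (W.eisensteinDVRSetting (κ.unitTwist (-1)) hm S hpS hbad L hL hLS jbar' cd Dd fs).T (W.eisensteinDVRSetting (κ.unitTwist (-1)) hm S hpS hbad L hL hLS jbar' cd Dd fs).π (W.eisensteinDVRSetting (κ.unitTwist (-1)) hm S hpS hbad L hL hLS jbar' cd Dd fs).e hy.killed hy.ker_red hπ he) j c) ∈
            (W.baseChange K).selmerInfty κ →
            galoisCohomology.localization ((W.eisensteinDVRSetting (κ.unitTwist (-1)) hm S hpS hbad L hL hLS jbar' cd Dd fs).T.ρ j) (Sum.inr v) 1 c ∈ Fv) ∧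
          Finite (↥Fv ⧸ (AdicTower.condA (W.eisensteinDVRSetting (κ.unitTwist (-1)) hm S hpS hbad L hL hLS jbar' cd Dd fs).T (W.eisensteinDVRSetting (κ.unitTwist (-1)) hm S hpS hbad L hL hLS jbar' cd Dd fs).π (W.eisensteinDVRSetting (κ.unitTwist (-1)) hm S hpS hbad L hL hLS jbar' cd Dd fs).e hy.killed hy.ker_red hπ he
                (fun k => ((W.eisensteinDVRSetting (κ.unitTwist (-1)) hm S hpS hbad L hL hLS jbar' cd Dd fs).t k).cond) j (Sum.inr v)).addSubgroupOf Fv) ∧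
          Nat.card (↥Fv ⧸ (AdicTower.condA (W.eisensteinDVRSetting (κ.unitTwist (-1)) hm S hpS hbad L hL hLS jbar' cd Dd fs).T (W.eisensteinDVRSetting (κ.unitTwist (-1)) hm S hpS hbad L hL hLS jbar' cd Dd fs).π (W.eisensteinDVRSetting (κ.unitTwist (-1)) hm S hpS hbad L hL hLS jbar' cd Dd fs).e hy.killed hy.ker_red hπ he
                (fun k => ((W.eisensteinDVRSetting (κ.unitTwist (-1)) hm S hpS hbad L hL hLS jbar' cd Dd fs).t k).cond) j (Sum.inr v)).addSubgroupOf Fv) ≤ p ^ (cP + cB) := by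
    intro j v
    by_cases hj : j₁ + j₂ + j₃ ≤ j
    · by_cases hv : v ∈ S
      · by_cases hp : ((p : ℕ) : NumberField.RingOfIntegers K) ∈ v.asIdeal
        · obtain ⟨Fv, h1, h2, h3⟩ := hP₂ j (hj₂ j hj) v hv hp
          exact ⟨Fv, fun _ _ ↦ ⟨h1, h2, h3.trans (Nat.pow_le_pow_right hppos (Nat.le_add_right _ _))⟩⟩
        · obtain ⟨Fv, h1, h2, h3⟩ := hB₂ j (hj₃ j hj) v hv hp
          exact ⟨Fv, fun _ _ ↦ ⟨h1, h2, h3.trans (Nat.pow_le_pow_right hppos (Nat.le_add_left _ _))⟩⟩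
      · exact ⟨⊤, fun _ h ↦ (hv h).elim⟩
    · exact ⟨⊤, fun h _ ↦ (hj h).elim⟩
  let F' : ∀ j, SelmerStructure ((W.eisensteinDVRSetting (κ.unitTwist (-1)) hm S hpS hbad L hL hLS jbar' cd Dd fs).T.ρ j) := fun j v ↦
    match v with
    | Sum.inl _ => ⊤
    | Sum.inr v => Classical.choose (hex j v)
  -- (hS') the relaxed conditions contain the local classes
  have hS' : ∀ j, j₁ + j₂ + j₃ ≤ j → ∀ c : galoisCohomology ((W.eisensteinDVRSetting (κ.unitTwist (-1)) hm S hpS hbad L hL hLS jbar' cd Dd fs).T.ρ j) 1,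
      W.eisensteinTowerReadout κ hm (W.eisensteinDVRSetting (κ.unitTwist (-1)) hm S hpS hbad L hL hLS jbar' cd Dd fs).π (W.eisensteinDVRSetting (κ.unitTwist (-1)) hm S hpS hbad L hL hLS jbar' cd Dd fs).e hy.killed hy.ker_red hπ he hπX hek
              (AddCommGroup.DirectLimit.of (fun k => galoisCohomology ((W.eisensteinDVRSetting (κ.unitTwist (-1)) hm S hpS hbad L hL hLS jbar' cd Dd fs).T.ρ k) 1)
                (AdicTower.incH1LE (W.eisensteinDVRSetting (κ.unitTwist (-1)) hm S hpS hbad L hL hLS jbar' cd Dd fs).T (W.eisensteinDVRSetting (κ.unitTwist (-1)) hm S hpS hbad L hL hLS jbar' cd Dd fs).π (W.eisensteinDVRSetting (κ.unitTwist (-1)) hm S hpS hbad L hL hLS jbar' cd Dd fs).e hy.killed hy.ker_red hπ he) j c) ∈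
            (W.baseChange K).selmerInfty κ →
      ∀ v ∈ S, galoisCohomology.localization ((W.eisensteinDVRSetting (κ.unitTwist (-1)) hm S hpS hbad L hL hLS jbar' cd Dd fs).T.ρ j) (Sum.inr v) 1 c ∈ F' j (Sum.inr v) :=
    fun j hj c hc v hv ↦ ((Classical.choose_spec (hex j v)) hj hv).1 c hc
  -- (hoff) outside `S`: Howard's condition itself
  have hoff' : ∀ j, j₁ + j₂ + j₃ ≤ j → ∀ c : galoisCohomology ((W.eisensteinDVRSetting (κ.unitTwist (-1)) hm S hpS hbad L hL hLS jbar' cd Dd fs).T.ρ j) 1,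
      W.eisensteinTowerReadout κ hm (W.eisensteinDVRSetting (κ.unitTwist (-1)) hm S hpS hbad L hL hLS jbar' cd Dd fs).π (W.eisensteinDVRSetting (κ.unitTwist (-1)) hm S hpS hbad L hL hLS jbar' cd Dd fs).e hy.killed hy.ker_red hπ he hπX hek
              (AddCommGroup.DirectLimit.of (fun k => galoisCohomology ((W.eisensteinDVRSetting (κ.unitTwist (-1)) hm S hpS hbad L hL hLS jbar' cd Dd fs).T.ρ k) 1)
                (AdicTower.incH1LE (W.eisensteinDVRSetting (κ.unitTwist (-1)) hm S hpS hbad L hL hLS jbar' cd Dd fs).T (W.eisensteinDVRSetting (κ.unitTwist (-1)) hm S hpS hbad L hL hLS jbar' cd Dd fs).π (W.eisensteinDVRSetting (κ.unitTwist (-1)) hm S hpS hbad L hL hLS jbar' cd Dd fs).e hy.killed hy.ker_red hπ he) j c) ∈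
            (W.baseChange K).selmerInfty κ →
      ∀ v ∉ S, galoisCohomology.localization ((W.eisensteinDVRSetting (κ.unitTwist (-1)) hm S hpS hbad L hL hLS jbar' cd Dd fs).T.ρ j) (Sum.inr v) 1 c ∈
        AdicTower.condA (W.eisensteinDVRSetting (κ.unitTwist (-1)) hm S hpS hbad L hL hLS jbar' cd Dd fs).T (W.eisensteinDVRSetting (κ.unitTwist (-1)) hm S hpS hbad L hL hLS jbar' cd Dd fs).π (W.eisensteinDVRSetting (κ.unitTwist (-1)) hm S hpS hbad L hL hLS jbar' cd Dd fs).e hy.killed hy.ker_red hπ he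
                (fun k => ((W.eisensteinDVRSetting (κ.unitTwist (-1)) hm S hpS hbad L hL hLS jbar' cd Dd fs).t k).cond) j (Sum.inr v) :=
    fun j hj c hc v hv ↦ hOff₂ j (hj₁ j hj) c hc v hv
  -- (hinf) the infinite places are complex
  have hinf' : ∀ j, j₁ + j₂ + j₃ ≤ j → ∀ c : galoisCohomology ((W.eisensteinDVRSetting (κ.unitTwist (-1)) hm S hpS hbad L hL hLS jbar' cd Dd fs).T.ρ j) 1,
      W.eisensteinTowerReadout κ hm (W.eisensteinDVRSetting (κ.unitTwist (-1)) hm S hpS hbad L hL hLS jbar' cd Dd fs).π (W.eisensteinDVRSetting (κ.unitTwist (-1)) hm S hpS hbad L hL hLS jbar' cd Dd fs).e hy.killed hy.ker_red hπ he hπX hek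
              (AddCommGroup.DirectLimit.of (fun k => galoisCohomology ((W.eisensteinDVRSetting (κ.unitTwist (-1)) hm S hpS hbad L hL hLS jbar' cd Dd fs).T.ρ k) 1)
                (AdicTower.incH1LE (W.eisensteinDVRSetting (κ.unitTwist (-1)) hm S hpS hbad L hL hLS jbar' cd Dd fs).T (W.eisensteinDVRSetting (κ.unitTwist (-1)) hm S hpS hbad L hL hLS jbar' cd Dd fs).π (W.eisensteinDVRSetting (κ.unitTwist (-1)) hm S hpS hbad L hL hLS jbar' cd Dd fs).e hy.killed hy.ker_red hπ he) j c) ∈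
            (W.baseChange K).selmerInfty κ →
      ∀ w : InfinitePlace K, galoisCohomology.localization ((W.eisensteinDVRSetting (κ.unitTwist (-1)) hm S hpS hbad L hL hLS jbar' cd Dd fs).T.ρ j) (Sum.inl w) 1 c ∈
        AdicTower.condA (W.eisensteinDVRSetting (κ.unitTwist (-1)) hm S hpS hbad L hL hLS jbar' cd Dd fs).T (W.eisensteinDVRSetting (κ.unitTwist (-1)) hm S hpS hbad L hL hLS jbar' cd Dd fs).π (W.eisensteinDVRSetting (κ.unitTwist (-1)) hm S hpS hbad L hL hLS jbar' cd Dd fs).e hy.killed hy.ker_red hπ he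
                (fun k => ((W.eisensteinDVRSetting (κ.unitTwist (-1)) hm S hpS hbad L hL hLS jbar' cd Dd fs).t k).cond) j (Sum.inl w) := by
    intro j _ c _ w
    have h0 := galoisCohomology_one_toLocal_inl_eq_zero_of_isComplex ((W.eisensteinDVRSetting (κ.unitTwist (-1)) hm S hpS hbad L hL hLS jbar' cd Dd fs).T.ρ j)
      (IsTotallyComplex.isComplex w) (galoisCohomology.localization ((W.eisensteinDVRSetting (κ.unitTwist (-1)) hm S hpS hbad L hL hLS jbar' cd Dd fs).T.ρ j) (Sum.inl w) 1 c)
    rw [h0]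
    exact zero_mem _
  -- (hfin)
  have hfin' : ∀ j, j₁ + j₂ + j₃ ≤ j → ∀ v ∈ S, Finite (↥(F' j (Sum.inr v)) ⧸
      (AdicTower.condA (W.eisensteinDVRSetting (κ.unitTwist (-1)) hm S hpS hbad L hL hLS jbar' cd Dd fs).T (W.eisensteinDVRSetting (κ.unitTwist (-1)) hm S hpS hbad L hL hLS jbar' cd Dd fs).π (W.eisensteinDVRSetting (κ.unitTwist (-1)) hm S hpS hbad L hL hLS jbar' cd Dd fs).e hy.killed hy.ker_red hπ he
                (fun k => ((W.eisensteinDVRSetting (κ.unitTwist (-1)) hm S hpS hbad L hL hLS jbar' cd Dd fs).t k).cond) j (Sum.inr v)).addSubgroupOf (F' j (Sum.inr v))) :=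
    fun j hj v hv ↦ ((Classical.choose_spec (hex j v)) hj hv).2.1
  -- (hC) `∏_{v ∈ S} ≤ (p^(cP+cB))^#S ≤ p^((cP+cB) #S₀)`
  have hC' : ∀ j, j₁ + j₂ + j₃ ≤ j → ∏ v ∈ S, Nat.card (↥(F' j (Sum.inr v)) ⧸
      (AdicTower.condA (W.eisensteinDVRSetting (κ.unitTwist (-1)) hm S hpS hbad L hL hLS jbar' cd Dd fs).T (W.eisensteinDVRSetting (κ.unitTwist (-1)) hm S hpS hbad L hL hLS jbar' cd Dd fs).π (W.eisensteinDVRSetting (κ.unitTwist (-1)) hm S hpS hbad L hL hLS jbar' cd Dd fs).e hy.killed hy.ker_red hπ he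
                (fun k => ((W.eisensteinDVRSetting (κ.unitTwist (-1)) hm S hpS hbad L hL hLS jbar' cd Dd fs).t k).cond) j (Sum.inr v)).addSubgroupOf (F' j (Sum.inr v))) ≤ p ^ ((cP + cB) * hS₀.toFinset.card) := by
    intro j hj
    refine (Finset.prod_le_pow_card S _ (p ^ (cP + cB))
      (fun v hv ↦ ((Classical.choose_spec (hex j v)) hj hv).2.2)).trans ?_
    rw [← pow_mul]
    exact Nat.pow_le_pow_right hppos (Nat.mul_le_mul_left _ hScard)
  exact W.finite_and_natCard_kerPsi_quotient_eisensteinTowerReadout_le_of_local κ hm hyp.topGenerator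
    hyp.noPTorsion S hpS hbad L hL hLS jbar' cd Dd fs hy hπ he hπX hek S F' (j₁ + j₂ + j₃)
    (p ^ ((cP + cB) * hS₀.toFinset.card)) hS' hoff' hinf' hfin' hC'

end Summit.BirchSwinnertonDyer.BirchSwinnertonDyer.Theorems.HeegnerMuPartControlGlue

end
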